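import Mathlib
import Summits.KontsevichZagierPeriods.Statement
import Literature.NumberTheory.Transcendental.Sweep1

/-!
# KontsevichZagierPeriods / NoriTransfer — assembly

Problem `KontsevichZagierPeriods`, topic `NoriTransfer`. Settles the rank-1 assembly item
stmt-KontsevichZagierPeriods-0192: (Kontsevich's formal period conjecture for some period datum
`(P, R, B, σ)` together with an additive KZ-transfer `Φ` sending formal relators into
`KZ.relations` and admitting a section on rational representations) implies the summit
`KontsevichZagierPeriods`. Pure algebra. (Modulo soundness of the KZ calculus the antecedent — route thesis
stmt-KontsevichZagierPeriods-0190 — is false as typed, see `Refutations.lean`; the implication is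
nevertheless the intended assembly and is proved directly.)
[Huber–Müller-Stach 2017, §13.1]
-/

namespace Summit.KontsevichZagierPeriods.NoriTransfer


/-- Settles stmt-KontsevichZagierPeriods-0192 (route NoriTransfer, assembly): if some period datum
`(P, R, B, σ)` over `ℚ̄` satisfies Kontsevich's formal period conjecture and carries an additive
transfer `Φ` from formal period symbols to formal KZ representations mapping formal relators into
`KZ.relations`, such that every rational representation `r` has a symbol `x` with
`Φ x - [r] ∈ KZ.relations` and `ev x = value r`, then the Kontsevich–Zagier period conjecture holds.
Proof: for rational `r, r'` of equal value pick `x, x'`; `ev (x - x') = 0`, so `x - x'` is a formal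
relator, so `Φ (x - x') ∈ KZ.relations`, and `[r] - [r'] = Φ (x - x') - (Φ x - [r]) + (Φ x' - [r'])`.
[folklore] -/
theorem nori_assembly :
    (∃ (P : Literature.AlgebraicGeometry.Motives.PeriodRealization (AlgebraicClosure ℚ)) (R : Literature.AlgebraicGeometry.Motives.RelativePeriodData P)
        (B : R.BoundaryData) (σ : AlgebraicClosure ℚ →+* ℂ),
      Literature.NumberTheory.Transcendental.KontsevichPeriodConjecture R B σ ∧
        ∃ Φ : Literature.NumberTheory.Transcendental.FreePeriodSymbols R σ →+ Literature.NumberTheory.Transcendental.KZ.FormalRep,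
          (∀ x ∈ Literature.NumberTheory.Transcendental.formalPeriodRelations R B σ, Φ x ∈ Literature.NumberTheory.Transcendental.KZ.relations) ∧
          (∀ (n : ℕ) (r : Literature.NumberTheory.Transcendental.KZ.IntegralRep n), r.IsRational →
            ∃ x, Φ x - Literature.NumberTheory.Transcendental.KZ.of r ∈ Literature.NumberTheory.Transcendental.KZ.relations ∧
              Literature.AlgebraicGeometry.Motives.AlongHom.equiv σ (Literature.NumberTheory.Transcendental.formalPeriodEval R σ x) = (r.value : ℂ))) →
      KontsevichZagierPeriods := by
  rintro ⟨P, R, B, σ, hK, Φ, hrel, hsec⟩ n m r r2 hr hr2 hv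
  obtain ⟨x, hx, hex⟩ := hsec n r hr
  obtain ⟨x2, hx2, hex2⟩ := hsec m r2 hr2
  have hev : Literature.NumberTheory.Transcendental.formalPeriodEval R σ x = Literature.NumberTheory.Transcendental.formalPeriodEval R σ x2 :=
    (Literature.AlgebraicGeometry.Motives.AlongHom.equiv σ).injective (by rw [hex, hex2, hv])
  have hker : Literature.NumberTheory.Transcendental.formalPeriodEval R σ (x - x2) = 0 := by rw [map_sub, hev, sub_self]
  have h1 : Φ (x - x2) ∈ Literature.NumberTheory.Transcendental.KZ.relations := hrel _ (hK _ hker)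
  have e : Literature.NumberTheory.Transcendental.KZ.of r - Literature.NumberTheory.Transcendental.KZ.of r2 = Φ (x - x2) - (Φ x - Literature.NumberTheory.Transcendental.KZ.of r) + (Φ x2 - Literature.NumberTheory.Transcendental.KZ.of r2) := by
    rw [map_sub]; abel
  show Literature.NumberTheory.Transcendental.KZ.of r - Literature.NumberTheory.Transcendental.KZ.of r2 ∈ Literature.NumberTheory.Transcendental.KZ.relations
  rw [e]
  exact Literature.NumberTheory.Transcendental.KZ.relations.add_mem (Literature.NumberTheory.Transcendental.KZ.relations.sub_mem h1 hx) hx2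

/-- Settles the RETYPED assembly stmt-KontsevichZagierPeriods-0192 (route NoriTransfer), matching
the retyped thesis stmt-KontsevichZagierPeriods-0190: the transfer `Φ` is now an additive map on
the FREE ABELIAN GROUP of period symbols `FreeAbelianGroup (PeriodSymbol R σ)` (integral form; the
earlier typing on the `ℚ̄`-vector space `FreePeriodSymbols R σ` forced `Φ = 0`, see
`Refutations.lean`), compared with the `ℚ̄`-symbols through
`ι = FreeAbelianGroup.lift (s ↦ single s 1)`. Hypotheses: Kontsevich's formal period conjecture
for `(P, R, B, σ)`; relator transfer `ι x ∈ formalPeriodRelations → Φ x ∈ KZ.relations` for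
integral symbols `x`; a section on rational representations (`Φ x - [r] ∈ KZ.relations`,
`ev (ι x) = value r`). Conclusion: the summit. Same three-line algebra as `nori_assembly`.
[folklore] -/
theorem nori_assembly_integral :
    (∃ (P : Literature.AlgebraicGeometry.Motives.PeriodRealization (AlgebraicClosure ℚ)) (R : Literature.AlgebraicGeometry.Motives.RelativePeriodData P) (B : R.BoundaryData) (σ : AlgebraicClosure ℚ →+* ℂ), Literature.NumberTheory.Transcendental.KontsevichPeriodConjecture R B σ ∧ ∃ Φ : FreeAbelianGroup (Literature.NumberTheory.Transcendental.PeriodSymbol R σ) →+ Literature.NumberTheory.Transcendental.KZ.FormalRep, (∀ x : FreeAbelianGroup (Literature.NumberTheory.Transcendental.PeriodSymbol R σ), FreeAbelianGroup.lift (fun s : Literature.NumberTheory.Transcendental.PeriodSymbol R σ => (Finsupp.single s 1 : Literature.NumberTheory.Transcendental.FreePeriodSymbols R σ)) x ∈ Literature.NumberTheory.Transcendental.formalPeriodRelations R B σ → Φ x ∈ Literature.NumberTheory.Transcendental.KZ.relations) ∧ (∀ (n : ℕ) (r : Literature.NumberTheory.Transcendental.KZ.IntegralRep n), r.IsRational →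 ∃ x : FreeAbelianGroup (Literature.NumberTheory.Transcendental.PeriodSymbol R σ), Φ x - Literature.NumberTheory.Transcendental.KZ.of r ∈ Literature.NumberTheory.Transcendental.KZ.relations ∧ Literature.AlgebraicGeometry.Motives.AlongHom.equiv σ (Literature.NumberTheory.Transcendental.formalPeriodEval R σ (FreeAbelianGroup.lift (fun s : Literature.NumberTheory.Transcendental.PeriodSymbol R σ => (Finsupp.single s 1 : Literature.NumberTheory.Transcendental.FreePeriodSymbols R σ)) x)) = (r.value : ℂ))) →
      KontsevichZagierPeriods := by
  rintro ⟨P, R, B, σ, hK, Φ, hrel, hsec⟩ n m r r2 hr hr2 hv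
  obtain ⟨x, hx, hex⟩ := hsec n r hr
  obtain ⟨x2, hx2, hex2⟩ := hsec m r2 hr2
  set ι := FreeAbelianGroup.lift (fun s : Literature.NumberTheory.Transcendental.PeriodSymbol R σ =>
    (Finsupp.single s 1 : Literature.NumberTheory.Transcendental.FreePeriodSymbols R σ)) with hι
  have hev : Literature.NumberTheory.Transcendental.formalPeriodEval R σ (ι x) = Literature.NumberTheory.Transcendental.formalPeriodEval R σ (ι x2) :=
    (Literature.AlgebraicGeometry.Motives.AlongHom.equiv σ).injective (by rw [hex, hex2, hv])
  have hker : Literature.NumberTheory.Transcendental.formalPeriodEval R σ (ι (x - x2)) = 0 := by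
    rw [map_sub, map_sub, hev, sub_self]
  have h1 : Φ (x - x2) ∈ Literature.NumberTheory.Transcendental.KZ.relations := hrel _ (hK _ hker)
  have e : Literature.NumberTheory.Transcendental.KZ.of r - Literature.NumberTheory.Transcendental.KZ.of r2 =
      Φ (x - x2) - (Φ x - Literature.NumberTheory.Transcendental.KZ.of r) + (Φ x2 - Literature.NumberTheory.Transcendental.KZ.of r2) := by
    rw [map_sub]; abel
  show Literature.NumberTheory.Transcendental.KZ.of r - Literature.NumberTheory.Transcendental.KZ.of r2 ∈ Literature.NumberTheory.Transcendental.KZ.relations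
  rw [e]
  exact Literature.NumberTheory.Transcendental.KZ.relations.add_mem (Literature.NumberTheory.Transcendental.KZ.relations.sub_mem h1 hx) hx2

end Summit.KontsevichZagierPeriods.NoriTransfer
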